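import Summits.Ventures.GridStability.Lyapunov.RelativeLffLevelTest
import HarnessLib

/-!
# GridStability/Lyapunov/RelativeLffLevelTestData — the decidable «K ⊂ S» box test for ANY member of the Lyapunov-function family
# on model-1's unordered-line presentation (numeric `Q`, `K` — e.g. an SDP certificate of record or a fault-adapted LFF)

Venture GRIDFUSION (LADDER-GRIDFUSION G1-cct; memo #41 §3.S20 lever «fault-adapted LFF»; seat gridfusion-model-1 g8).  GENERIC in `d : RecastData n`.
`RelativeLffLevelTest.lean` (p557192) bounds the CLOSED-FORM certificate `certU` (whose `Q` is the Sherman–Morrison block matrix).  HERE the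
same bound for an ARBITRARY certificate `Λ : Certificate (d.lffSystemU λ θ*)` whose data are given as rationals: a matrix
`A : (Fin n ⊕ Fin n)² → ℚ` with `Λ.Q p q = A p q` and nonnegative line weights `w : LffLine n → ℚ` with `Λ.K_k = w_k` (lyap-1's certificate OF
RECORD `NE39LLffOso.cert` — `Q = Qs`, `K = Kq` of `NE39LLffOsoData` — is such a member by `NE39LLffOso.lffSystemU_eq : … := rfl`; so is any
future SDP / fault-adapted member typed through lit-6's `Certificate.ofSecondOrder`).
* `V_eq_of_lineData` — `Λ.V (lffState θ* x) = ½ yᵀQy − Σ_k K_k (cos(a_i − a_j) + (a_i − a_j)·sd_ij)` (`a_i = δ_i − δ_0`; `sd` exact).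
* `potHiQw`, `VhiQw A w lo hi Sb := quadBoxQ A zLo zHi / 2 + potHiQw w Sb` and the SOUNDNESS `V_le_VhiQw` on any `SwingTube.SliceBox` passing
  `boxOKQ` (node tables `lo ≤ θ* ≤ hi`); the polytope test is `RelativeLff.lffState_mem_polytope_of_polyOKQ` unchanged.
THREE COLUMNS: theorem schema about MODEL M′ (lossless network-reduced classical model, uniform damping; MV-2L + MV-λ, + MV-RD/MV-h12 per
instance); CERTIFIED per instance = rational inequalities; VALIDATED nothing.  No sentence here says that any grid is stable.  Definitions =
rational bookkeeping; no named fact; standard axioms.  [cite: VuTuritsyn2016, §III eq. (Lyapunov), §IV set ℛ; Moore1979, §8.1 eq. (8.10)]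
-/

noncomputable section

open Set Real Matrix Finset Literature.MathematicalPhysics.PowerSystems
open Literature.MathematicalPhysics.PowerSystems.LyapunovFunctionFamily
open Summit.Ventures.GridStability.Models Summit.Ventures.GridStability.Models.AngleEnclosure

namespace Summit.Ventures.GridStability.Lyapunov.RelativeLff

variable {n : ℕ} (d : RecastData n)

/-- **`V` of any family member on a machine state**, written with the line angles `a_i − a_j` and the EXACT `sd_ij = sin(θ*_i − θ*_j)`.
[cite: VuTuritsyn2016, §III eq. (Lyapunov)] -/
theorem V_eq_of_lineData (lam : ℚ) (Λ : Certificate (d.lffSystemU lam d.angleOf)) (hE : d.EqData d.angleOf)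
    (x : ClassicalSwing.State (n + 1)) :
    Λ.V (RecastData.lffState d.angleOf x) =
      1 / 2 * (RecastData.lffState d.angleOf x ⬝ᵥ (Λ.Q *ᵥ RecastData.lffState d.angleOf x)) -
        ∑ k : RecastData.LffLine n, Λ.kK k *
          (Real.cos (relAngle x k.1.1 - relAngle x k.1.2) +
            (relAngle x k.1.1 - relAngle x k.1.2) * (d.sd k.1.1 k.1.2 : ℝ)) := by
  unfold Certificate.V
  congr 1
  refine Finset.sum_congr rfl fun k _ => ?_
  have hδ : (d.lffSystemU lam d.angleOf).δs k = d.angleOf k.1.1 - d.angleOf k.1.2 := rfl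
  rw [lineAngle_lffState d lam d.angleOf x k, hδ, ← d.sd_cast hE]

/-- Rational UPPER bound of the potential part `−Σ_k w_k (cos(a_i − a_j) + (a_i − a_j)·sd_ij)` on the box, for arbitrary nonnegative
line weights `w`. -/
def potHiQw (w : RecastData.LffLine n → ℚ) (Sb : SwingTube.SliceBox (n + 1)) : ℚ :=
  -∑ k : RecastData.LffLine n, w k *
      (SwingTube.cosRLo (dLoQ Sb k.1.1 k.1.2) (dHiQ Sb k.1.1 k.1.2) +
        min (dLoQ Sb k.1.1 k.1.2 * d.sd k.1.1 k.1.2) (dHiQ Sb k.1.1 k.1.2 * d.sd k.1.1 k.1.2))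

/-- **THE RATIONAL UPPER BOUND OF `V` ON THE BOX for rational data `(A, w)`.** -/
def VhiQw (A : Fin n ⊕ Fin n → Fin n ⊕ Fin n → ℚ) (w : RecastData.LffLine n → ℚ) (lo hi : Fin (n + 1) → ℚ)
    (Sb : SwingTube.SliceBox (n + 1)) : ℚ :=
  quadBoxQ A (zLoQ lo hi Sb) (zHiQ lo hi Sb) / 2 + potHiQw d w Sb

/-- One line of the potential part with weight `w_k ≥ 0`. -/
theorem potLine_le_w (w : RecastData.LffLine n → ℚ) (hw : ∀ k, 0 ≤ w k) {Sb : SwingTube.SliceBox (n + 1)}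
    (hok : boxOKQ Sb = true) {x : ClassicalSwing.State (n + 1)} (hx : x ∈ Sb.toSet) (k : RecastData.LffLine n) :
    (w k : ℝ) * (((SwingTube.cosRLo (dLoQ Sb k.1.1 k.1.2) (dHiQ Sb k.1.1 k.1.2) : ℚ) : ℝ) +
        ((min (dLoQ Sb k.1.1 k.1.2 * d.sd k.1.1 k.1.2) (dHiQ Sb k.1.1 k.1.2 * d.sd k.1.1 k.1.2) : ℚ) : ℝ)) ≤
      (w k : ℝ) * (Real.cos (relAngle x k.1.1 - relAngle x k.1.2) +
        (relAngle x k.1.1 - relAngle x k.1.2) * (d.sd k.1.1 k.1.2 : ℝ)) := by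
  simp only [boxOKQ, decide_eq_true_eq] at hok
  obtain ⟨h3l, h3u⟩ := hok k.1.1 k.1.2 k.2
  obtain ⟨hd1, hd2⟩ := lineAngle_mem hx k.1.1 k.1.2
  have hcos := SwingTube.cosRLo_le h3l h3u hd1 hd2
  have hlin := (SwingTube.mul_mem_minmax ((d.sd k.1.1 k.1.2 : ℚ) : ℝ) hd1 hd2).1
  have hwk : (0 : ℝ) ≤ (w k : ℝ) := by exact_mod_cast hw k
  have hmin : ((min (dLoQ Sb k.1.1 k.1.2 * d.sd k.1.1 k.1.2) (dHiQ Sb k.1.1 k.1.2 * d.sd k.1.1 k.1.2) : ℚ) : ℝ) ≤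
      (relAngle x k.1.1 - relAngle x k.1.2) * (d.sd k.1.1 k.1.2 : ℝ) := by
    rw [Rat.cast_min, Rat.cast_mul, Rat.cast_mul, mul_comm ((dLoQ Sb k.1.1 k.1.2 : ℚ) : ℝ),
      mul_comm ((dHiQ Sb k.1.1 k.1.2 : ℚ) : ℝ), mul_comm (relAngle x k.1.1 - relAngle x k.1.2)]
    exact hlin
  exact mul_le_mul_of_nonneg_left (add_le_add hcos hmin) hwk

/-- The cast of `potHiQw`, term by term. -/
theorem potHiQw_cast (w : RecastData.LffLine n → ℚ) (Sb : SwingTube.SliceBox (n + 1)) :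
    ((potHiQw d w Sb : ℚ) : ℝ) = -∑ k : RecastData.LffLine n, (w k : ℝ) *
        (((SwingTube.cosRLo (dLoQ Sb k.1.1 k.1.2) (dHiQ Sb k.1.1 k.1.2) : ℚ) : ℝ) +
          ((min (dLoQ Sb k.1.1 k.1.2 * d.sd k.1.1 k.1.2) (dHiQ Sb k.1.1 k.1.2 * d.sd k.1.1 k.1.2) : ℚ) : ℝ)) := by
  simp only [potHiQw, Rat.cast_neg, Rat.cast_sum, Rat.cast_mul, Rat.cast_add]

/-- **SOUNDNESS FOR RATIONAL DATA: `V ≤ VhiQw A w` on the box** for every family member whose `Q` has the rational entries `A`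
and whose line gains are the nonnegative rationals `w`. [cite: VuTuritsyn2016, §III eq. (Lyapunov)] -/
theorem V_le_VhiQw (lam : ℚ) (Λ : Certificate (d.lffSystemU lam d.angleOf))
    (A : Fin n ⊕ Fin n → Fin n ⊕ Fin n → ℚ) (w : RecastData.LffLine n → ℚ)
    (hQ : ∀ p q, Λ.Q p q = ((A p q : ℚ) : ℝ)) (hK : ∀ k, Λ.kK k = ((w k : ℚ) : ℝ)) (hw : ∀ k, 0 ≤ w k)
    (hE : d.EqData d.angleOf) {lo hi : Fin (n + 1) → ℚ} (hlo : ∀ i, (lo i : ℝ) ≤ d.angleOf i)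
    (hhi : ∀ i, d.angleOf i ≤ (hi i : ℝ)) {Sb : SwingTube.SliceBox (n + 1)} (hok : boxOKQ Sb = true)
    {x : ClassicalSwing.State (n + 1)} (hx : x ∈ Sb.toSet) :
    Λ.V (RecastData.lffState d.angleOf x) ≤ ((VhiQw d A w lo hi Sb : ℚ) : ℝ) := by
  rw [V_eq_of_lineData d lam Λ hE x]
  have hquad : RecastData.lffState d.angleOf x ⬝ᵥ (Λ.Q *ᵥ RecastData.lffState d.angleOf x) ≤
      ((quadBoxQ A (zLoQ lo hi Sb) (zHiQ lo hi Sb) : ℚ) : ℝ) := by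
    have h := quad_le_quadBoxQ A (zLoQ lo hi Sb) (zHiQ lo hi Sb) (RecastData.lffState d.angleOf x)
      (lffState_mem d hlo hhi hx)
    have e : RecastData.lffState d.angleOf x ⬝ᵥ (Λ.Q *ᵥ RecastData.lffState d.angleOf x) =
        ∑ p, RecastData.lffState d.angleOf x p * ∑ q, ((A p q : ℚ) : ℝ) * RecastData.lffState d.angleOf x q := by
      simp only [dotProduct, Matrix.mulVec, hQ]
    rw [e]; exact h
  have hpot := Finset.sum_le_sum fun k (_ : k ∈ (Finset.univ : Finset (RecastData.LffLine n))) =>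
    potLine_le_w d w hw hok hx k
  have hKsum : ∑ k : RecastData.LffLine n, Λ.kK k *
        (Real.cos (relAngle x k.1.1 - relAngle x k.1.2) + (relAngle x k.1.1 - relAngle x k.1.2) * (d.sd k.1.1 k.1.2 : ℝ)) =
      ∑ k : RecastData.LffLine n, (w k : ℝ) *
        (Real.cos (relAngle x k.1.1 - relAngle x k.1.2) + (relAngle x k.1.1 - relAngle x k.1.2) * (d.sd k.1.1 k.1.2 : ℝ)) :=
    Finset.sum_congr rfl fun k _ => by rw [hK k]
  have hV : ((VhiQw d A w lo hi Sb : ℚ) : ℝ) =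
      ((quadBoxQ A (zLoQ lo hi Sb) (zHiQ lo hi Sb) : ℚ) : ℝ) / 2 + ((potHiQw d w Sb : ℚ) : ℝ) := by
    simp only [VhiQw, Rat.cast_add, Rat.cast_div, Rat.cast_ofNat]
  rw [hKsum, hV, potHiQw_cast]
  linarith [hquad, hpot]

end Summit.Ventures.GridStability.Lyapunov.RelativeLff

end
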